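import Summits.ValiantsHypothesis.ValiantsHypothesis.Theorems.BarrierLeverPartitionMinorsMooreBenchReduction

/-!
# Route BarrierLever — item 22038 `ChowBenchmarkPairs`, line `moore-peel`: the registered stub
# `stub_dualisation` (segment moments ⟹ the free-node benchmark minor)

Helper file (`--supports stmt-ValiantsHypothesis-22038`; cell valiant-natproofs, rung V4, 𝒟-side
benchmark of record; seat valiant-natproofs-prover gen 15; line
`Cruxes/ChowBenchmarkPairs/Lines/moore_peel.lean`, planner p1 g19).  Closes NO item; definition-free.

The item `ChowBenchmarkPairs` (free-node form of prover g14's `MoorePeel.MCBenchPairsAt`): for every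
height `h`, rows = all subsets of `Fin h` of size `≤ 2`, columns = the first `r` binary codes
(`MoorePeel.benchCols`), SOME table `B : Fin h → Fin h → ℂ` makes the partition minor
`[coeff_{x^{u i} y^{T_j}} ∏_a (x_a + 1 + Σ_c B_{a c} y_c)]` nonsingular.  The line's TRANSFER stub says
that it suffices to make the SEGMENT-MOMENT matrix `[segEntry P (u i) T_j]` nonsingular, where
`segEntry P S T = Σ_{g : T → S} ∏_{c∈T} P_{g(c),c} · ∏_{a∈S} |g⁻¹(a)|!` (for `S = {a,b}` this is
`(|T|+1)!` times the `z^T`-moment of the uniform measure on the segment `[P_a, P_b]`).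

Proof (val-np-p2 g8's Γ-reduction, `ChowCube.det_xPrivate_eq_det_thetaHat`): for the x-private design
the benchmark minor equals `det Θ̂[u, benchCols]`, `Θ̂[i,j] = coeff_{y^{T_j}} ∏_{a ∈ u i} t_a` with the
truncated inverses `t_a = Σ_S (-1)^{|S|}|S|! B_a^S y^S`; the benchmark columns are injective and
down-closed (`MoorePeel.benchCols_injective/_downClosed`, `r = c_{h+1} ≤ 2^h`).  For rows of size
`≤ 2` the entries of `Θ̂` are `(-1)^{|T_j|} · segEntry B (u i) T_j` (`thetaHat_*_row` of val-np-p2 +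
the three evaluations `segSum_empty/_singleton/_pair` below), so the two determinants agree up to the
sign `∏_j (-1)^{|T_j|}` (`Matrix.det_mul_row`); take `B := P`.

* `segSum_empty`, `segSum_singleton`, `segSum_pair` — the segment sums for `|S| ≤ 2` in closed form;
* `thetaHat_row_eq_sign_mul_segSum` — `Θ̂[S,T] = (-1)^{|T|}·segEntry` for `|S| ≤ 2`;
* **`stub_dualisation`** — the registered stub, with the line file's `SegmentMeanValueAt`, `segEntry`,
  `ChowBenchPairsAt` unfolded verbatim (the line file closes its `sorry` by `exact` this).

WHAT THIS IS NOT: an identity (bookkeeping); the ∀h content of item 22038 is the line's stub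
`stub_segmentMeanValue` (open); nothing on items 20172 / 19717, crux stmt-ValiantsHypothesis-14610, or
`VP` versus `VNP`.
-/

set_option linter.dupNamespace false

namespace Summit.ValiantsHypothesis.ValiantsHypothesis.Theorems.BarrierLever.ChowBenchmarkDual

open MvPolynomial Finset
open Summit.ValiantsHypothesis.ValiantsHypothesis.Theorems.BarrierLever.MoorePeel
  (benchCols benchCols_injective benchCols_downClosed card_filter_card_le_two windowStart
    windowStart_succ_le_two_pow eq_empty_or_singleton_or_pair)
open Summit.ValiantsHypothesis.ValiantsHypothesis.Theorems.BarrierLever.ChowCube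
  (det_xPrivate_eq_det_thetaHat thetaHat_empty_row thetaHat_singleton_row thetaHat_insert)

variable {h : ℕ}

/-! ## 1. The segment sums for rows of size `≤ 2` -/

/-- Row `∅`: `segEntry P ∅ T = [T = ∅]` (a map `T → ∅` exists iff `T = ∅`). -/
theorem segSum_empty (P : Fin h → Fin h → ℂ) (T : Finset (Fin h)) :
    (∑ g : (↥T → ↥(∅ : Finset (Fin h))), (∏ c : ↥T, P (g c) c) *
        ∏ a : ↥(∅ : Finset (Fin h)),
          ((Finset.univ.filter fun c : ↥T => g c = a).card.factorial : ℂ)) =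
      if T = ∅ then 1 else 0 := by
  classical
  by_cases hT : T = ∅
  · subst hT
    rw [if_pos rfl]
    haveI : Unique (↥(∅ : Finset (Fin h)) → ↥(∅ : Finset (Fin h))) := Pi.uniqueOfIsEmpty _
    rw [Fintype.sum_unique]
    simp
  · rw [if_neg hT]
    haveI : Nonempty ↥T := by
      obtain ⟨c, hc⟩ := Finset.nonempty_iff_ne_empty.mpr hT
      exact ⟨⟨c, hc⟩⟩
    haveI : IsEmpty (↥T → ↥(∅ : Finset (Fin h))) := by infer_instance
    exact Fintype.sum_empty _

/-- Row `{a}`: `segEntry P {a} T = |T|! · ∏_{c∈T} P a c` (the only map is the constant one). -/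
theorem segSum_singleton (P : Fin h → Fin h → ℂ) (a : Fin h) (T : Finset (Fin h)) :
    (∑ g : (↥T → ↥({a} : Finset (Fin h))), (∏ c : ↥T, P (g c) c) *
        ∏ a' : ↥({a} : Finset (Fin h)),
          ((Finset.univ.filter fun c : ↥T => g c = a').card.factorial : ℂ)) =
      (T.card.factorial : ℂ) * ∏ c ∈ T, P a c := by
  classical
  haveI hU : Unique ↥({a} : Finset (Fin h)) :=
    ⟨⟨⟨a, Finset.mem_singleton_self a⟩⟩, fun x => Subtype.ext (Finset.mem_singleton.mp x.2)⟩
  rw [Fintype.sum_unique]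
  set g₀ : ↥T → ↥({a} : Finset (Fin h)) := default with hg₀
  have hg : ∀ c : ↥T, ((g₀ c : ↥({a} : Finset (Fin h))) : Fin h) = a := fun c =>
    Finset.mem_singleton.mp (g₀ c).2
  rw [Fintype.prod_unique (fun a' : ↥({a} : Finset (Fin h)) =>
    ((Finset.univ.filter fun c : ↥T => g₀ c = a').card.factorial : ℂ))]
  have hfilter : (Finset.univ.filter fun c : ↥T => g₀ c = default) = Finset.univ :=
    Finset.filter_true_of_mem fun c _ => Unique.eq_default _
  rw [hfilter, Finset.card_univ, Fintype.card_coe, mul_comm]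
  congr 1
  rw [← Finset.prod_coe_sort T (fun c => P a c)]
  exact Finset.prod_congr rfl fun c _ => by rw [hg c]

/-- Row `{a, b}` (`a ≠ b`): `segEntry P {a,b} T = Σ_{d ⊆ T} |d|!·|T∖d|!·(∏_{c∈d} P a c)(∏_{c∈T∖d} P b c)`
(a map `g : T → {a,b}` is the same as the subset `d = g⁻¹(a) ⊆ T`). -/
theorem segSum_pair (P : Fin h → Fin h → ℂ) (a b : Fin h) (hab : a ≠ b) (T : Finset (Fin h)) :
    (∑ g : (↥T → ↥({a, b} : Finset (Fin h))), (∏ c : ↥T, P (g c) c) *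
        ∏ a' : ↥({a, b} : Finset (Fin h)),
          ((Finset.univ.filter fun c : ↥T => g c = a').card.factorial : ℂ)) =
      ∑ d ∈ T.powerset, (d.card.factorial : ℂ) * ((T \ d).card.factorial : ℂ) *
        ((∏ c ∈ d, P a c) * ∏ c ∈ T \ d, P b c) := by
  classical
  have ha : a ∈ ({a, b} : Finset (Fin h)) := by simp
  have hb : b ∈ ({a, b} : Finset (Fin h)) := by simp
  -- the subset `d(g) = g⁻¹(a)` and the map `g(d)`
  let dOf : (↥T → ↥({a, b} : Finset (Fin h))) → Finset (Fin h) := fun g =>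
    (Finset.univ.filter fun c : ↥T => ((g c : ↥({a, b} : Finset (Fin h))) : Fin h) = a).map
      (Function.Embedding.subtype _)
  let gOf : Finset (Fin h) → (↥T → ↥({a, b} : Finset (Fin h))) := fun d c =>
    if (c : Fin h) ∈ d then ⟨a, ha⟩ else ⟨b, hb⟩
  have mem_dOf : ∀ g (c : Fin h), c ∈ dOf g ↔ ∃ hc : c ∈ T, ((g ⟨c, hc⟩ : Fin h)) = a := by
    intro g c
    simp only [dOf, Finset.mem_map, Finset.mem_filter, Finset.mem_univ, true_and,
      Function.Embedding.coe_subtype, Subtype.exists, exists_and_right, exists_eq_right]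
  have dOf_sub : ∀ g, dOf g ⊆ T := fun g c hc => ((mem_dOf g c).mp hc).1
  have gval : ∀ (g : ↥T → ↥({a, b} : Finset (Fin h))) (c : ↥T),
      ((g c : Fin h) = a ∧ (c : Fin h) ∈ dOf g) ∨ ((g c : Fin h) = b ∧ (c : Fin h) ∉ dOf g) := by
    intro g c
    rcases Finset.mem_insert.mp (g c).2 with hga | hgb
    · exact Or.inl ⟨hga, (mem_dOf g c).mpr ⟨c.2, by simpa using hga⟩⟩
    · rw [Finset.mem_singleton] at hgb
      refine Or.inr ⟨hgb, fun hc => ?_⟩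
      obtain ⟨hc', e⟩ := (mem_dOf g c).mp hc
      exact hab (by rw [← hgb]; simpa using e.symm)
  refine Finset.sum_bij' (fun g _ => dOf g) (fun d _ => gOf d) ?_ ?_ ?_ ?_ ?_
  · exact fun g _ => Finset.mem_powerset.mpr (dOf_sub g)
  · exact fun d _ => Finset.mem_univ _
  · -- gOf (dOf g) = g
    intro g _
    funext c
    rcases gval g c with ⟨hga, hcd⟩ | ⟨hgb, hcd⟩
    · exact Subtype.ext (by simp only [gOf, if_pos hcd]; exact hga.symm)
    · exact Subtype.ext (by simp only [gOf, if_neg hcd]; exact hgb.symm)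
  · -- dOf (gOf d) = d
    intro d hd
    have hdT : d ⊆ T := Finset.mem_powerset.mp hd
    ext c
    rw [mem_dOf]
    constructor
    · rintro ⟨hc, e⟩
      by_contra hcd
      simp only [gOf, if_neg hcd] at e
      exact hab e.symm
    · intro hcd
      exact ⟨hdT hcd, by simp only [gOf, if_pos hcd]⟩
  · -- the summand
    intro g _
    set d := dOf g with hd
    have hdT : d ⊆ T := dOf_sub g
    -- the product of the table entries
    have hprod : (∏ c : ↥T, P (g c) c) = (∏ c ∈ d, P a c) * ∏ c ∈ T \ d, P b c := by
      have e1 : (∏ c : ↥T, P (g c) c) = ∏ c : ↥T, (if (c : Fin h) ∈ d then P a c else P b c) := by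
        refine Finset.prod_congr rfl fun c _ => ?_
        rcases gval g c with ⟨hga, hcd⟩ | ⟨hgb, hcd⟩
        · rw [if_pos hcd, hga]
        · rw [if_neg hcd, hgb]
      rw [e1, Finset.prod_coe_sort T (fun c => if c ∈ d then P a c else P b c), Finset.prod_ite,
        Finset.filter_mem_eq_inter, Finset.inter_eq_right.mpr hdT, Finset.filter_not,
        Finset.filter_mem_eq_inter, Finset.inter_eq_right.mpr hdT]
    -- the factorial weights
    have hfa : (Finset.univ.filter fun c : ↥T => ((g c : ↥({a, b} : Finset (Fin h))) : Fin h) = a).card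
        = d.card := by
      rw [hd]
      simp only [dOf, Finset.card_map]
    have hfb : (Finset.univ.filter fun c : ↥T => ((g c : ↥({a, b} : Finset (Fin h))) : Fin h) = b).card
        = (T \ d).card := by
      have e1 : (Finset.univ.filter fun c : ↥T => ((g c : ↥({a, b} : Finset (Fin h))) : Fin h) = b) =
          Finset.univ.filter fun c : ↥T => ¬ (((g c : ↥({a, b} : Finset (Fin h))) : Fin h) = a) := by
        ext c
        simp only [Finset.mem_filter, Finset.mem_univ, true_and]
        rcases gval g c with ⟨hga, _⟩ | ⟨hgb, _⟩
        · rw [hga]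
          exact ⟨fun e => absurd e hab, fun ne => absurd rfl ne⟩
        · rw [hgb]
          exact ⟨fun _ => fun e => hab e.symm, fun _ => rfl⟩
      rw [e1, Finset.filter_not, Finset.card_sdiff_of_subset (Finset.filter_subset _ _), hfa,
        Finset.card_univ, Fintype.card_coe, Finset.card_sdiff_of_subset hdT]
    have hw : (∏ a' : ↥({a, b} : Finset (Fin h)),
        ((Finset.univ.filter fun c : ↥T => g c = a').card.factorial : ℂ)) =
        (d.card.factorial : ℂ) * ((T \ d).card.factorial : ℂ) := by
      have e : ∀ a' : ↥({a, b} : Finset (Fin h)), (Finset.univ.filter fun c : ↥T => g c = a') =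
          Finset.univ.filter fun c : ↥T => ((g c : ↥({a, b} : Finset (Fin h))) : Fin h) = (a' : Fin h) :=
        fun a' => by
          ext c
          simp only [Finset.mem_filter, Finset.mem_univ, true_and]
          exact ⟨fun e => by rw [e], fun e => Subtype.ext e⟩
      simp_rw [e]
      rw [Finset.prod_coe_sort ({a, b} : Finset (Fin h)) (fun x : Fin h =>
        ((Finset.univ.filter fun c : ↥T => ((g c : ↥({a, b} : Finset (Fin h))) : Fin h) = x).card.factorial
          : ℂ)), Finset.prod_pair hab, hfa, hfb]
    rw [hprod, hw]
    ring

/-! ## 2. Rows of `Θ̂` of size `≤ 2` are signed segment sums -/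

/-- **`Θ̂[S, T] = (-1)^{|T|} · segEntry q S T` for `|S| ≤ 2`.**  Row `∅`: both sides are `[T = ∅]`;
row `{a}`: `(-1)^{|T|}|T|! q_a^T`; row `{a, b}`: `thetaHat_insert` + the singleton row give
`Σ_{d ⊆ T} ((-1)^{|T∖d|}|T∖d|! q_b^{T∖d})((-1)^{|d|}|d|! q_a^d)`, and `segSum_pair` the same sum unsigned. -/
theorem thetaHat_row_eq_sign_mul_segSum (q : Fin h → Fin h → ℂ) (S : Finset (Fin h)) (hS : S.card ≤ 2)
    (T : Finset (Fin h)) :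
    coeff (∑ a ∈ (∅ : Finset (Fin h)), Finsupp.single (Fin.castAdd h a) 1 +
        ∑ c ∈ T, Finsupp.single (Fin.natAdd h c) 1)
      (∏ a ∈ S, ∑ S' ∈ (Finset.univ : Finset (Fin h)).powerset,
        monomial (∑ a' ∈ (∅ : Finset (Fin h)), Finsupp.single (Fin.castAdd h a') 1 +
          ∑ c ∈ S', Finsupp.single (Fin.natAdd h c) 1)
          ((-1 : ℂ) ^ S'.card * (S'.card.factorial : ℂ) * ∏ c ∈ S', q a c) :
            MvPolynomial (Fin (h + h)) ℂ) =
      (-1 : ℂ) ^ T.card *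
        ∑ g : (↥T → ↥S), (∏ c : ↥T, q (g c) c) *
          ∏ a : ↥S, ((Finset.univ.filter fun c : ↥T => g c = a).card.factorial : ℂ) := by
  classical
  rcases eq_empty_or_singleton_or_pair S hS with h0 | ⟨b, hb⟩ | ⟨b, b', hlt, hbb⟩
  · subst h0
    rw [thetaHat_empty_row, segSum_empty]
    by_cases hT : T = ∅
    · subst hT
      simp
    · rw [if_neg hT, mul_zero]
  · subst hb
    rw [thetaHat_singleton_row, segSum_singleton, mul_assoc]
  · subst hbb
    have hne : b ≠ b' := ne_of_lt hlt
    rw [show ({b, b'} : Finset (Fin h)) = insert b {b'} from rfl,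
      thetaHat_insert _ b {b'} _ (by rw [Finset.mem_singleton]; exact hne)]
    simp_rw [thetaHat_singleton_row]
    rw [show (insert b {b'} : Finset (Fin h)) = {b, b'} from rfl, segSum_pair q b b' hne T,
      Finset.mul_sum]
    refine Finset.sum_congr rfl fun d hd => ?_
    have hdT : d ⊆ T := Finset.mem_powerset.mp hd
    rw [← Finset.card_sdiff_add_card_eq_card hdT, pow_add]
    ring

/-! ## 3. The registered stub `stub_dualisation` -/

/-- The rows of size `≤ 2` are counted by `c_{h+1} = 1 + h + C(h,2)`: an injective enumeration `u` of
exactly these sets has `r = c_{h+1}`. -/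
theorem eq_windowStart_of_enumeration {r : ℕ} (u : Fin r → Finset (Fin h)) (hu : Function.Injective u)
    (hcard : ∀ i, (u i).card ≤ 2) (hsurj : ∀ S : Finset (Fin h), S.card ≤ 2 → ∃ i, u i = S) :
    r = windowStart (h + 1) := by
  classical
  have himg : Finset.univ.image u =
      (Finset.univ : Finset (Finset (Fin h))).filter fun S => S.card ≤ 2 := by
    ext S
    simp only [Finset.mem_image, Finset.mem_univ, true_and, Finset.mem_filter]
    constructor
    · rintro ⟨i, rfl⟩
      exact hcard i
    · intro hS
      obtain ⟨i, hi⟩ := hsurj S hS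
      exact ⟨i, hi⟩
  have := congrArg Finset.card himg
  rwa [Finset.card_image_of_injective _ hu, Finset.card_univ, Fintype.card_fin,
    card_filter_card_le_two] at this

/-- **Registered stub `stub_dualisation` of the line `moore-peel` (item 22038 `ChowBenchmarkPairs`):
segment mean-value unisolvence at height `h` implies the free-node benchmark at height `h`.**
The hypothesis and conclusion are the line file's `SegmentMeanValueAt h` and `ChowBenchPairsAt h` with
`segEntry` unfolded verbatim.  Proof: Γ-reduction `det_xPrivate_eq_det_thetaHat` (benchmark columns are
injective and down-closed since `r = c_{h+1} ≤ 2^h`), the row identity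
`thetaHat_row_eq_sign_mul_segSum`, and `Matrix.det_mul_row` (the column signs `(-1)^{|T_j|}` are
units); the free-node table is the point table itself, `B := P`. -/
theorem stub_dualisation : ∀ h : ℕ,
    (∀ (r : ℕ) (u : Fin r → Finset (Fin h)), Function.Injective u → (∀ i, (u i).card ≤ 2) →
      (∀ S : Finset (Fin h), S.card ≤ 2 → ∃ i, u i = S) →
      ∃ P : Fin h → Fin h → ℂ,
        (Matrix.of fun i j : Fin r =>
          ∑ g : (↥(benchCols h r j) → ↥(u i)), (∏ c : ↥(benchCols h r j), P (g c) c) *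
            ∏ a : ↥(u i),
              ((Finset.univ.filter fun c : ↥(benchCols h r j) => g c = a).card.factorial : ℂ)).det ≠ 0) →
    ∀ (r : ℕ) (u : Fin r → Finset (Fin h)), Function.Injective u → (∀ i, (u i).card ≤ 2) →
      (∀ S : Finset (Fin h), S.card ≤ 2 → ∃ i, u i = S) →
      ∃ B : Fin h → Fin h → ℂ,
        (Matrix.of fun i j : Fin r => MvPolynomial.coeff
          (∑ a ∈ u i, Finsupp.single (Fin.castAdd h a) 1 +
            ∑ c ∈ benchCols h r j, Finsupp.single (Fin.natAdd h c) 1)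
          (∏ a : Fin h, (MvPolynomial.X (Fin.castAdd h a) + 1 +
            ∑ c : Fin h, MvPolynomial.C (B a c) * MvPolynomial.X (Fin.natAdd h c)))).det ≠ 0 := by
  classical
  intro h hseg r u hu hcard hsurj
  obtain ⟨P, hP⟩ := hseg r u hu hcard hsurj
  refine ⟨P, ?_⟩
  have hr2 : r ≤ 2 ^ h := by
    rw [eq_windowStart_of_enumeration u hu hcard hsurj]
    exact windowStart_succ_le_two_pow h
  have hassoc : (∏ a : Fin h, (X (Fin.castAdd h a) + 1 +
      ∑ c : Fin h, C (P a c) * X (Fin.natAdd h c)) : MvPolynomial (Fin (h + h)) ℂ) =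
      ∏ a : Fin h, (X (Fin.castAdd h a) + (1 + ∑ c : Fin h, C (P a c) * X (Fin.natAdd h c))) :=
    Finset.prod_congr rfl fun a _ => add_assoc _ _ _
  rw [hassoc, det_xPrivate_eq_det_thetaHat P u (benchCols h r) (benchCols_injective hr2)
    (fun j S hS => benchCols_downClosed hr2 j S hS)]
  let v : Fin r → ℂ := fun j => (-1 : ℂ) ^ (benchCols h r j).card
  let M : Matrix (Fin r) (Fin r) ℂ := Matrix.of fun i j : Fin r =>
    ∑ g : (↥(benchCols h r j) → ↥(u i)), (∏ c : ↥(benchCols h r j), P (g c) c) *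
      ∏ a : ↥(u i), ((Finset.univ.filter fun c : ↥(benchCols h r j) => g c = a).card.factorial : ℂ)
  have hentry : (Matrix.of fun i j' : Fin r => coeff
      (∑ a ∈ (∅ : Finset (Fin h)), Finsupp.single (Fin.castAdd h a) 1 +
          ∑ c ∈ benchCols h r j', Finsupp.single (Fin.natAdd h c) 1)
        (∏ a ∈ u i, ∑ S ∈ (Finset.univ : Finset (Fin h)).powerset,
          monomial (∑ a' ∈ (∅ : Finset (Fin h)), Finsupp.single (Fin.castAdd h a') 1 +
            ∑ c ∈ S, Finsupp.single (Fin.natAdd h c) 1)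
            ((-1 : ℂ) ^ S.card * (S.card.factorial : ℂ) * ∏ c ∈ S, P a c) :
              MvPolynomial (Fin (h + h)) ℂ)) =
      Matrix.of fun i j : Fin r => v j * M i j := by
    ext i j
    simp only [Matrix.of_apply, v, M]
    exact thetaHat_row_eq_sign_mul_segSum P (u i) (hcard i) (benchCols h r j)
  rw [hentry, Matrix.det_mul_row]
  refine mul_ne_zero (Finset.prod_ne_zero_iff.mpr fun j _ => pow_ne_zero _ (by norm_num)) ?_
  exact hP

end Summit.ValiantsHypothesis.ValiantsHypothesis.Theorems.BarrierLever.ChowBenchmarkDual
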